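import Summits.ResolutionOfSingularities.ResolutionOfSingularities.Theorems.FrobeniusClosingPatchingRelPerfectDepthLegalTrace
import Summits.ResolutionOfSingularities.ResolutionOfSingularities.Theorems.FrobeniusClosingPatchingRelPerfectDepthMonomialHostLaw
import Literature.AlgebraicGeometry.Resolution.HasSNCStrictNormalCrossings
import Literature.AlgebraicGeometry.Resolution.KollarMaxContactPersistence
import Literature.AlgebraicGeometry.Resolution.SncParameterExchange
import Literature.AlgebraicGeometry.Resolution.RegularSystemOfParameters
import HarnessLib

/-!
# Crux `PatchingRelPerfect` (stmt-ResolutionOfSingularities-16161), chain W5.2 — T6-E1b residual `LegalScopedDivisorReduction₃`,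
# PHASE 2 closer (2b), brick B2′: the EXIT — a host DISJOINT from the positive boundary gives an snc support

[OURS · L1 W5.2 · res-L1-w52-lead-1 g5, hand #3b; plan `L/res-L1-w52-lead-1/PHASE2-SEPARATION-GAME.md` v2] Replaces the role of NO printed item;
NOT a statement of the manuscript under review; fact-free.

The separation game (brick B1, `…DepthLegalTrace`) ends when the trace of the boundary monomial on the host is EMPTY: no boundary
component of positive exponent meets `X = V(D)`. Then `X ∪ Supp M` is a strict normal crossings divisor — at a point of `X` only the
regular hypersurface `X` is present (its order-one generator extends to a regular system of parameters, `rsop_update`), elsewhere only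
the snc boundary — and it contains `Supp H = Supp D ∪ Supp M`:

* `HostState.hasSNC_cons_of_disjoint` — `HasSNC (D :: Es)` for any sub-family `Es` of the boundary disjoint from the host;
* `HostState.exists_snc_support_of_disjoint` — the EXIT in res-L1-w52-idea-1's `SncSupport` shape:
  `∃ B, IsStrictNormalCrossingsDivisor E B ∧ Supp H ⊆ B`, from «every positive-exponent boundary member is disjoint from `Supp D`».

AI-written; AI review is weaker than expert review.

## References
* E. Bierstone, D. Grigoriev, P. Milman, J. Włodarczyk, arXiv:1206.3090, Def. 3.1.1, Lemma 3.6.4 (4). [BierstoneGrigorievMilmanWlodarczyk2011]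
* H. Matsumura, *Commutative Ring Theory* (1986), Thm. 14.2. [Matsumura1987]
-/

-- `Summit.<Summit>.<Sub>.Theorems` with `Sub = Summit` (single-conjunct summit, D-0017)
set_option linter.dupNamespace false

noncomputable section

open CategoryTheory CategoryTheory.Limits AlgebraicGeometry TopologicalSpace IsLocalRing
open Literature.AlgebraicGeometry.Resolution Scheme.IdealSheafData

namespace Summit.ResolutionOfSingularities.ResolutionOfSingularities.Theorems

universe u

namespace DepthLegal

namespace HostState

variable {E : Scheme.{u}} [IsLocallyNoetherian E] {H D : E.IdealSheafData} {L : List (E.IdealSheafData × ℕ)}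
  (S : HostState H D L)

/-- **An order-one generator extends to a regular system of parameters**: if `D_x = (v)` with `v ∈ 𝔪_x ∖ 𝔪_x²` in a regular local
ring, there is a regular system of parameters `u` and an index `i₀` with `u i₀ = v`. [cite: Matsumura1987, Thm. 14.2] -/
theorem exists_rsop_eq {R : Type u} [CommRing R] [IsRegularLocalRing R] {v : R} (hvm : v ∈ maximalIdeal R)
    (hv2 : v ∉ maximalIdeal R ^ 2) :
    ∃ (u : Fin (maximalIdeal R).spanFinrank → R) (i₀ : Fin (maximalIdeal R).spanFinrank),
      Ideal.span (Set.range u) = maximalIdeal R ∧ u i₀ = v := by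
  classical
  obtain ⟨x, hx⟩ := exists_regularSystemOfParameters (R := R)
  have hvx : v ∈ Ideal.span (Set.range x) := by rw [hx]; exact hvm
  obtain ⟨c, hc⟩ := Ideal.mem_span_range_iff_exists_fun.mp hvx
  have hnot : ∑ i ∈ (Finset.univ : Finset (Fin _)), c i * x i ∉ Ideal.span (x '' (∅ : Set _)) ⊔ maximalIdeal R ^ 2 := by
    rw [hc, Set.image_empty, Ideal.span_empty, bot_sup_eq]; exact hv2
  obtain ⟨i₀, -, -, hu⟩ := exists_isUnit_coeff_of_not_mem x hx Finset.univ ∅ c hnot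
  refine ⟨Function.update x i₀ (∑ i ∈ Finset.univ, c i * x i), i₀, (rsop_update x hx Finset.univ c (Finset.mem_univ i₀) hu).1, ?_⟩
  rw [Function.update_self, hc]

include S in
/-- [OURS · L1 W5.2] **Host + a boundary sub-family DISJOINT from it have simple normal crossings**: at a point of `X = V(D)` only the
regular hypersurface `X` is present (its order-one generator is a member of a regular system of parameters), at any other point only the
snc boundary. [cite: BierstoneGrigorievMilmanWlodarczyk2011, Def. 3.1.1] -/
theorem hasSNC_cons_of_disjoint (Es : List E.IdealSheafData) (hEs : ∀ F ∈ Es, F ∈ boundaryOf L)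
    (hdisj : ∀ F ∈ Es, Disjoint (D.support : Set E) F.support) : HasSNC (D :: Es) := by
  classical
  have hB : HasSNC Es := S.sncB.of_subset hEs
  refine hasSNC_of_labels _ fun x => ?_
  haveI : IsRegularLocalRing (E.presheaf.stalk x) := S.regE x
  by_cases hx : x ∈ D.support
  · -- only the host passes through `x`
    obtain ⟨v, hDx, hv2⟩ := S.hostHyp x hx
    have hvm : v ∈ maximalIdeal (E.presheaf.stalk x) :=
      (Ideal.span_singleton_le_iff_mem _).mp (hDx ▸ (mem_support_iff_stalkIdeal_le D x).mp hx)
    obtain ⟨u, i₀, hu, hui₀⟩ := exists_rsop_eq hvm hv2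
    have honly : ∀ G : {G : E.IdealSheafData // G ∈ D :: Es ∧ x ∈ G.support}, G.1 = D := by
      intro G
      rcases List.mem_cons.mp G.2.1 with h | h
      · exact h
      · exact absurd G.2.2 (Set.disjoint_left.mp (hdisj G.1 h) hx)
    refine ⟨‹_›, _, u, rfl, hu, fun _ => i₀, fun G₁ G₂ _ => Subtype.ext ((honly G₁).trans (honly G₂).symm), fun G => ?_⟩
    rw [honly G, hDx, hui₀]
  · -- only the boundary passes through `x`
    obtain ⟨hreg, u, hu, ⟨ι, hι, hιD⟩, -⟩ := hB x
    have hmem : ∀ G : {G : E.IdealSheafData // G ∈ D :: Es ∧ x ∈ G.support}, G.1 ∈ Es := by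
      intro G
      rcases List.mem_cons.mp G.2.1 with h | h
      · exact absurd (h ▸ G.2.2) hx
      · exact h
    refine ⟨hreg, _, u, rfl, hu, fun G => ι ⟨G.1, hmem G, G.2.2⟩, fun G₁ G₂ heq => ?_, fun G => hιD ⟨G.1, hmem G, G.2.2⟩⟩
    have e := congrArg Subtype.val (hι heq)
    exact Subtype.ext e

include S in
/-- [OURS · L1 W5.2] **THE EXIT of the separation game**: if every boundary member of positive exponent is DISJOINT from the host, the
support of `H = D · monomialIdeal L` lies in the strict normal crossings divisor `Supp D ∪ ⋃_{c_F ≥ 1} Supp F` (res-L1-w52-idea-1's `SncSupport`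
shape). [cite: BierstoneGrigorievMilmanWlodarczyk2011, Def. 3.1.1] -/
theorem exists_snc_support_of_disjoint (hdisj : ∀ p ∈ L, 0 < p.2 → Disjoint (D.support : Set E) p.1.support) :
    ∃ B : Set E, IsStrictNormalCrossingsDivisor E B ∧ (H.support : Set E) ⊆ B := by
  classical
  set Es : List E.IdealSheafData := boundaryOf (L.filter fun p => 0 < p.2) with hEs
  have hEsL : ∀ F ∈ Es, F ∈ boundaryOf L := by
    intro F hF
    obtain ⟨a, ha⟩ := mem_boundaryOf_iff.mp hF
    exact mem_boundaryOf_iff.mpr ⟨a, (List.mem_filter.mp ha).1⟩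
  have hdisj' : ∀ F ∈ Es, Disjoint (D.support : Set E) F.support := by
    intro F hF
    obtain ⟨a, ha⟩ := mem_boundaryOf_iff.mp hF
    obtain ⟨hmem, hpos⟩ := List.mem_filter.mp ha
    exact hdisj (F, a) hmem (by simpa using hpos)
  have hsnc := (S.hasSNC_cons_of_disjoint Es hEsL hdisj').isStrictNormalCrossingsDivisor_biUnion_support
  refine ⟨_, hsnc, fun x hx => ?_⟩
  -- `x ∈ Supp (D · M)` lies on `Supp D` or on a positive-exponent member
  haveI : IsRegularLocalRing (E.presheaf.stalk x) := S.regE x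
  rw [SetLike.mem_coe, S.fac, mem_support_iff_stalkIdeal_le, stalkIdeal_mul,
    (maximalIdeal.isMaximal _).isPrime.mul_le] at hx
  simp only [Set.mem_iUnion, List.mem_cons, exists_prop]
  rcases hx with h | h
  · exact ⟨D, Or.inl rfl, (mem_support_iff_stalkIdeal_le D x).mpr h⟩
  · obtain ⟨p, hp, hpos, hxp⟩ := DepthHostLaw.exists_mem_support_of_mem_support_monomialIdeal
      ((mem_support_iff_stalkIdeal_le _ x).mpr h)
    refine ⟨p.1, Or.inr ?_, hxp⟩
    exact mem_boundaryOf_iff.mpr ⟨p.2, List.mem_filter.mpr ⟨hp, by simpa using hpos⟩⟩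

end HostState

end DepthLegal

end Summit.ResolutionOfSingularities.ResolutionOfSingularities.Theorems

end
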